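import Summits.BirchSwinnertonDyer.BirchSwinnertonDyer.Theorems.QuadraticBranchSignedControlPlusEtaNonsurjConjADoorHeckeRecordsA
import Summits.BirchSwinnertonDyer.Rank1Residual.X11b.ChaPairsMinimality
import HarnessLib

/-!
# Route `QuadraticBranchSignedControl` (rung K8, cell `bsd-potss`), residual crux `PlusEtaMainConjectureNonsurj`
# (stmt-BirchSwinnertonDyer-19606): UNCONGRUENT RECORDS H — (C1⁺_η)@5 BY NAME through door L4 (Hecke) on the prime-`L` rank-one members u5a:53, 89,
# whose only g21 verdict was «killed by S-classes» at the (c3)-FAILING prime 11 (seat `bsd-potss-k8eta-c2` g22; kit j331462, engine e5h2, GRH)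

WHAT. u5a:53 (`h(ℚ(P)) = 150 = [30,5]`) and u5a:89 (`h = 1200 = [30,10,2,2]`) are prime-`L` rank-one members (`ε = −1`, PARI plus-`η` `(λ, μ) = (1, 0)`,
`r_an = 1`) of the UNCONGRUENT family u5a (`A = [1,−1,1,−4010,98676]`, Zywina's `X_ns⁺(5)` `t = 4/5`) with an eigenvalue-`2` class (`d₂ = 1`): doors
L6/L6⁻/L2 void; g21's «PASS-L3(S-classes)» is void as a door ((c3) fails at the split multiplicative 11, `c₁₁ = 5`; kernel reason p716503; at 89 the
(c3)-holding classes alone do not kill, j330922). This seat's Hecke run (conjA g13's operator on the whole eigenspace, engine e5h2) gives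
**53: `T_y = 0` (V₉-type), 89: `T_y = −Tr` (TWIST)** — `ρ̄` does not occur, (c2) for `W` HOLDS, door L4 passes (as it does on −68, −83: V₉; those are
rank-0 non-unit rows, no record shape). Records: `etaMC_r1_u5a_{53,89}_5_of_heckeEigenHom` (g21's `EtaConjADoorHeckeRecords.etaMC_r1_of_heckeEigenHom`,
p707571). With them the resolved u5a members stand: kernel-door PASS 21/22 (L6⁻ 12, L2 3, L4 6), RHO 1 (−31); uncongruent rows at (C1⁺_η) level by
name: 14 (g21: 6).

HONEST FRAMING (cell `bsd-potss`; FULL-BSD rank ≤ 1 programme, HUMAN RULING D-0036/D-0074): per-row RECORDS, CONDITIONAL on `h22 h41 h6273 hGZK` and the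
displayed per-row inputs (`r_an = 1`, tower clause, `(L_5⁺) = (X)`, the Hecke-refined eigen datum); GRH numerics are evidence; no stub of 19606 proved;
crux and route OPEN; nothing booked; `BSD(W,5)` claimed for no pair. `--supports stmt-BirchSwinnertonDyer-19606`.

References: [Kobayashi2003] Thm. 2.2, §4, Thm. 4.1; [CoatesSujatha2005] §3 (A); [DeoRaySujatha2023] Thm. 3.8–3.9; [Zywina2015] Thm. 1.4.
-/

set_option autoImplicit false
set_option linter.dupNamespace false
noncomputable section

open scoped Classical nonZeroDivisors

open CongruenceSubgroup NumberField Field WeierstrassCurve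
open Literature.NumberTheory.EllipticCurves Literature.NumberTheory.EllipticCurves.ModularForms
  Literature.NumberTheory.EllipticCurves.Rank1Residual Literature.NumberTheory.EllipticCurves.Rank1Residual.Typed
  Literature.NumberTheory.GaloisRepresentations Literature.NumberTheory.GaloisCohomology Literature.NumberTheory.NumberFields
  Literature.NumberTheory.EllipticCurves.GreenbergVatsal2000 ZpExtension
open Summit.BirchSwinnertonDyer.Rank1Residual Summit.BirchSwinnertonDyer.Rank1Residual.Additive
open Summit.BirchSwinnertonDyer.Rank1Residual.X11b (isElliptic_of_discOf_ne_zero)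
open Summit.BirchSwinnertonDyer.BirchSwinnertonDyer.Theorems
open Summit.BirchSwinnertonDyer.Rank1Residual.X11b (isElliptic_of_discOf_ne_zero)
open Summit.BirchSwinnertonDyer.BirchSwinnertonDyer.Theorems.EtaConjADoorHeckeRecords (etaMC_r1_of_heckeEigenHom)

namespace Summit.BirchSwinnertonDyer.BirchSwinnertonDyer.Theorems.EtaConjADoorUncongruentRecordsH

/-- The `5`-partner of u5a:53, `W = [1, -1, 1, -281580305, 1817743999572]` (non-CM, `N_W = 3065953275`; `j(W) = j(A)` for the quadratic twist
`A^{(53)}` of `A = [1,−1,1,−4010,98676]` (the `t = 4/5` point of Zywina's `X_ns⁺(5)` family; non-CM, mod-`5` image `C_ns⁺(5)`, NOT `5`-congruent to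
any CM row — k8eta-c2 g19 p666083: the domain of v7's hardest stub `stub_etaMC_nonCM_uncongruent`)): `Δ ≠ 0` (kernel). [cite: Zywina2015, Thm. 1.4]
-/
theorem isElliptic_u5a_53 : (⟨1, (-1), 1, (-281580305), 1817743999572⟩ : WeierstrassCurve ℚ).IsElliptic :=
  isElliptic_of_discOf_ne_zero 1 (-1) 1 (-281580305) 1817743999572 (by decide +kernel)

/-- **(C1⁺_η) at `p = 5` for every good `a_5 = 0` model `V` of the `5`-twist of the UNCONGRUENT prime-`L` rank-one partner u5a:53** (`W = [1, -1, 1,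
-281580305, 1817743999572]`, non-CM, `N_W = 3065953275`; kit j326613/j331462 (916 s, GRH): `ε(W) = −1`, PARI plus-`η` `(λ, μ) = (1, 0)`, `r_an(W) =
1` (`ellanalyticrank`); `h(ℚ(P)) = 150` (`[30,5]`), `h(ℚ(x(P))) = 15`; eigen dimensions `(d₁,d₂,d₃,d₄) = (0,1,0,1)`; Hecke datum (conjA g13 hecke13
engine, kit j331462 (engine e5h2)): `Tr ρ̄(y) = 2`, `T_y` acts on the tautological line by `c = 0 (T_y = 0 on the line)` — verdict `V₉`-TYPE (`T_y =
0`: the line belongs to a cubic-twist companion; (c2) for `W` holds) — the row's «S-classes» verdict of g21 was void ((c3) fails at 11), door L4 is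
its layer-0 door — door L4 (Hecke-refined eigen-test) passes) from the ROW ALONE — named facts `h22 h41 h6273 hGZK`; displayed: `r_an(W) = 1`, the
tower clause, `(L_5⁺(V,η,X)) = (X)`, the class-group datum. Instance of `EtaConjADoorHeckeRecords.etaMC_r1_of_heckeEigenHom` (p707571). CONDITIONAL;
nothing booked. [cite: Kobayashi2003, §4 (p. 8), Thm. 2.2 (p. 5)] [cite: CoatesSujatha2005, §3 (A) and Thm. 3.4] [cite: Zywina2015, Thm. 1.4] -/
theorem etaMC_r1_u5a_53_5_of_heckeEigenHom
    (h22 : Kobayashi2003.thm22_etaSignedSelmerDual_finite_torsion)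
    (h41 : Kobayashi2003.thm41_plusEtaCharIdeal_dvd)
    (h6273 : Kobayashi2003.thm62_63_73_etaColemanPoitouTate)
    (hGZK : rank_eq_analyticRank_of_analyticRank_le_one) [Fact (5 : ℕ).Prime]
    (W : WeierstrassCurve ℚ) (hW : W = (⟨1, (-1), 1, (-281580305), 1817743999572⟩ : WeierstrassCurve ℚ)) (hr : W.analyticRank = 1)
    (V : WeierstrassCurve ℚ) [V.IsElliptic] [V.IsGloballyMinimal] (C : VariableChange ℚ)
    (hC : C • W.quadraticTwist 5 = V)
    (hgood : V.HasGoodReductionAtPrime 5) (hap : V.frobeniusTrace 5 = 0)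
    (hns : ¬ ∀ m : ℕ, V.HasSurjectiveModNGaloisRep (5 ^ m : ℕ))
    (hX : ∀ {N : ℕ} [NeZero N] {f : CuspForm (Gamma0 N) 2}, IsNewformOf V f →
      ∀ (ϖ : ℚ), (if Even (5 / 2) then (ϖ : ℝ) * V.realPeriodRat = plusPeriod f
          else (ϖ : ℝ) * V.imaginaryPeriodRat = minusPeriod f) →
      ∀ (Lη : IwasawaAlgebra 5), IsQuadraticBranchPlusLFunction f 5 ϖ Lη →
        Ideal.span {Lη} = Ideal.span {(PowerSeries.X : IwasawaAlgebra 5)})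
    (hP : haveI : W.IsElliptic := hW ▸ isElliptic_u5a_53
      haveI : NeZero (5 : ℕ) := ⟨by norm_num⟩
      haveI : NumberField (W.divisionField 5) := NumberField.mk
      ∃ P : geomTorsion W ((5 : ℕ) : ℤ), P ≠ 0 ∧
        ∀ K : IntermediateField ℚ (W.divisionField 5),
          K = IntermediateField.fixedField
            ((MulAction.stabilizer (absoluteGaloisGroup ℚ) P).map (absRestrictNormalHom (W.divisionField 5))) →
        ∀ μ : Additive (ClassGroup (𝓞 K)) →+ ZMod 5,
          (∀ (τ : absoluteGaloisGroup ℚ) (σ : K ≃ₐ[ℚ] K) (a : ℕ),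
              (∀ x : K, absRestrictNormalHom (W.divisionField 5) τ (x : W.divisionField 5) =
                ((σ x : K) : W.divisionField 5)) → τ • P = a • P →
              ∀ (I J : (Ideal (𝓞 K))⁰),
                (J : Ideal (𝓞 K)) = (I : Ideal (𝓞 K)).map (AmbiguousClass.intAut σ : 𝓞 K →+* 𝓞 K) →
                μ (Additive.ofMul (ClassGroup.mk0 J)) = a • μ (Additive.ofMul (ClassGroup.mk0 I))) →
          (∀ (τ τ₁ : absoluteGaloisGroup ℚ) (a a₁ b : ℕ) (Q : geomTorsion W ((5 : ℕ) : ℤ)),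
              τ • P = a • P + Q → τ₁ • P = a₁ • P → τ₁ • Q = b • Q → (a₁ : ZMod 5) ≠ (b : ZMod 5) →
              ∀ I : (Ideal (𝓞 K))⁰,
                μ (Additive.ofMul (classGroupNorm K (W.divisionField 5) (ClassGroup.mulEquiv
                  (AmbiguousClass.intAut (absRestrictNormalHom (W.divisionField 5) τ))
                    (classGroupExtend K (W.divisionField 5) (ClassGroup.mk0 I))))) =
                  (Nat.card ((W.divisionField 5) ≃ₐ[K] (W.divisionField 5)) * a) •
                    μ (Additive.ofMul (ClassGroup.mk0 I))) →
          μ = 0) :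
    QuadraticBranchPlusEtaMainConjectureAt V 5 := by
  subst hW
  haveI : (⟨1, (-1), 1, (-281580305), 1817743999572⟩ : WeierstrassCurve ℚ).IsElliptic := isElliptic_u5a_53
  haveI : NeZero (5 : ℕ) := ⟨by norm_num⟩
  exact etaMC_r1_of_heckeEigenHom h22 h41 h6273 hGZK 5 (le_refl 5) _ hr V C
    (by rw [show ((-1 : ℚ) ^ ((5 : ℕ) / 2) * ((5 : ℕ) : ℚ)) = 5 by norm_num]; exact hC) hgood hap hns hX hP

/-- The `5`-partner of u5a:89, `W = [1, -1, 0, -794018367, 8607327498916]` (non-CM, `N_W = 8645573475`; `j(W) = j(A)` for the quadratic twist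
`A^{(89)}` of `A = [1,−1,1,−4010,98676]` (the `t = 4/5` point of Zywina's `X_ns⁺(5)` family; non-CM, mod-`5` image `C_ns⁺(5)`, NOT `5`-congruent to
any CM row — k8eta-c2 g19 p666083: the domain of v7's hardest stub `stub_etaMC_nonCM_uncongruent`)): `Δ ≠ 0` (kernel). [cite: Zywina2015, Thm. 1.4]
-/
theorem isElliptic_u5a_89 : (⟨1, (-1), 0, (-794018367), 8607327498916⟩ : WeierstrassCurve ℚ).IsElliptic :=
  isElliptic_of_discOf_ne_zero 1 (-1) 0 (-794018367) 8607327498916 (by decide +kernel)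

/-- **(C1⁺_η) at `p = 5` for every good `a_5 = 0` model `V` of the `5`-twist of the UNCONGRUENT prime-`L` rank-one partner u5a:89** (`W = [1, -1, 0,
-794018367, 8607327498916]`, non-CM, `N_W = 8645573475`; kit j326613/j331462 (3634 s, GRH): `ε(W) = −1`, PARI plus-`η` `(λ, μ) = (1, 0)`, `r_an(W) =
1` (`ellanalyticrank`); `h(ℚ(P)) = 1200` (`[30,10,2,2]`), `h(ℚ(x(P))) = 15`; eigen dimensions `(d₁,d₂,d₃,d₄) = (0,1,0,1)`; Hecke datum (conjA g13
hecke13 engine, kit j331462 (engine e5h2)): `Tr ρ̄(y) = 3`, `T_y` acts on the tautological line by `c = 2 = −Tr` — verdict TWIST-TYPE (`T_y = −Tr`: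
the line belongs to `ρ̄ ⊗ ε′`; (c2) for `W` holds) — g21's «S-classes» verdict void ((c3) fails at 11; the (c3)-holding 89-classes alone do not
kill, j330922), door L4 is its layer-0 door — door L4 (Hecke-refined eigen-test) passes) from the ROW ALONE — named facts `h22 h41 h6273 hGZK`;
displayed: `r_an(W) = 1`, the tower clause, `(L_5⁺(V,η,X)) = (X)`, the class-group datum. Instance of
`EtaConjADoorHeckeRecords.etaMC_r1_of_heckeEigenHom` (p707571). CONDITIONAL; nothing booked. [cite: Kobayashi2003, §4 (p. 8), Thm. 2.2 (p. 5)]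
[cite: CoatesSujatha2005, §3 (A) and Thm. 3.4] [cite: Zywina2015, Thm. 1.4] -/
theorem etaMC_r1_u5a_89_5_of_heckeEigenHom
    (h22 : Kobayashi2003.thm22_etaSignedSelmerDual_finite_torsion)
    (h41 : Kobayashi2003.thm41_plusEtaCharIdeal_dvd)
    (h6273 : Kobayashi2003.thm62_63_73_etaColemanPoitouTate)
    (hGZK : rank_eq_analyticRank_of_analyticRank_le_one) [Fact (5 : ℕ).Prime]
    (W : WeierstrassCurve ℚ) (hW : W = (⟨1, (-1), 0, (-794018367), 8607327498916⟩ : WeierstrassCurve ℚ)) (hr : W.analyticRank = 1)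
    (V : WeierstrassCurve ℚ) [V.IsElliptic] [V.IsGloballyMinimal] (C : VariableChange ℚ)
    (hC : C • W.quadraticTwist 5 = V)
    (hgood : V.HasGoodReductionAtPrime 5) (hap : V.frobeniusTrace 5 = 0)
    (hns : ¬ ∀ m : ℕ, V.HasSurjectiveModNGaloisRep (5 ^ m : ℕ))
    (hX : ∀ {N : ℕ} [NeZero N] {f : CuspForm (Gamma0 N) 2}, IsNewformOf V f →
      ∀ (ϖ : ℚ), (if Even (5 / 2) then (ϖ : ℝ) * V.realPeriodRat = plusPeriod f
          else (ϖ : ℝ) * V.imaginaryPeriodRat = minusPeriod f) →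
      ∀ (Lη : IwasawaAlgebra 5), IsQuadraticBranchPlusLFunction f 5 ϖ Lη →
        Ideal.span {Lη} = Ideal.span {(PowerSeries.X : IwasawaAlgebra 5)})
    (hP : haveI : W.IsElliptic := hW ▸ isElliptic_u5a_89
      haveI : NeZero (5 : ℕ) := ⟨by norm_num⟩
      haveI : NumberField (W.divisionField 5) := NumberField.mk
      ∃ P : geomTorsion W ((5 : ℕ) : ℤ), P ≠ 0 ∧
        ∀ K : IntermediateField ℚ (W.divisionField 5),
          K = IntermediateField.fixedField
            ((MulAction.stabilizer (absoluteGaloisGroup ℚ) P).map (absRestrictNormalHom (W.divisionField 5))) →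
        ∀ μ : Additive (ClassGroup (𝓞 K)) →+ ZMod 5,
          (∀ (τ : absoluteGaloisGroup ℚ) (σ : K ≃ₐ[ℚ] K) (a : ℕ),
              (∀ x : K, absRestrictNormalHom (W.divisionField 5) τ (x : W.divisionField 5) =
                ((σ x : K) : W.divisionField 5)) → τ • P = a • P →
              ∀ (I J : (Ideal (𝓞 K))⁰),
                (J : Ideal (𝓞 K)) = (I : Ideal (𝓞 K)).map (AmbiguousClass.intAut σ : 𝓞 K →+* 𝓞 K) →
                μ (Additive.ofMul (ClassGroup.mk0 J)) = a • μ (Additive.ofMul (ClassGroup.mk0 I))) →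
          (∀ (τ τ₁ : absoluteGaloisGroup ℚ) (a a₁ b : ℕ) (Q : geomTorsion W ((5 : ℕ) : ℤ)),
              τ • P = a • P + Q → τ₁ • P = a₁ • P → τ₁ • Q = b • Q → (a₁ : ZMod 5) ≠ (b : ZMod 5) →
              ∀ I : (Ideal (𝓞 K))⁰,
                μ (Additive.ofMul (classGroupNorm K (W.divisionField 5) (ClassGroup.mulEquiv
                  (AmbiguousClass.intAut (absRestrictNormalHom (W.divisionField 5) τ))
                    (classGroupExtend K (W.divisionField 5) (ClassGroup.mk0 I))))) =
                  (Nat.card ((W.divisionField 5) ≃ₐ[K] (W.divisionField 5)) * a) •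
                    μ (Additive.ofMul (ClassGroup.mk0 I))) →
          μ = 0) :
    QuadraticBranchPlusEtaMainConjectureAt V 5 := by
  subst hW
  haveI : (⟨1, (-1), 0, (-794018367), 8607327498916⟩ : WeierstrassCurve ℚ).IsElliptic := isElliptic_u5a_89
  haveI : NeZero (5 : ℕ) := ⟨by norm_num⟩
  exact etaMC_r1_of_heckeEigenHom h22 h41 h6273 hGZK 5 (le_refl 5) _ hr V C
    (by rw [show ((-1 : ℚ) ^ ((5 : ℕ) / 2) * ((5 : ℕ) : ℚ)) = 5 by norm_num]; exact hC) hgood hap hns hX hP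

end Summit.BirchSwinnertonDyer.BirchSwinnertonDyer.Theorems.EtaConjADoorUncongruentRecordsH

end
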